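import Summits.Ventures.PercRepro.RankLevelSetLevelTenInfraGXT

/-!
# PercRepro — THE `Y`-SIDE TAILS OF THE LEVEL-`10` GXT CHAIN AT BASE `403`, PART DW: the coranks `d = 725 … 726`
(p2, gen 35; a feeder for S4 — the top of the `q = 10` window, from `1,088`)

The per-corank form `c₁·U_b ≤ c₂·2^{d−10}·C(p+10, 10)` of RankLevelSetLevelTenGXTBArith{AA…} leaves the `Y`-side the share
`(c₁ − c₂)/c₁` of `2^n`: it needs `c₁·(#{r ≤ 10} + #{spanning}) ≤ (c₁ − c₂)·2^n` at `n = p + d`, which the level-`10` tail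
`G₁₀(d, n) = C(n,10)·2^{min 629 d} + C(n,9)·2^310 + C(n,8)·2^151 + … + C(n,2)·2 + n + 1 + Σ_{j ≤ d} C(n, j)` (the flat tail through the
`e`-free flat bounds `639 / 319 / 159 / 79 / 39 / 19 / 10 / 6 / 3 / 1` with the nullity cap on the rank-`10` term, plus the spanning tail)
bounds: the NUMERICAL bases `c₁·G₁₀(d, 403 + d) ≤ (c₁ − c₂)·2^{403 + d}` below, lifted to every `n ≥ 403 + d` by the doubling step
`mul_tailG_ten_le_of_base` (RankLevelSetLevelTenInfraGXT). Generated by gen_gxt10.py. Axioms: standard.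
-/

set_option exponentiation.threshold 4096

namespace PercRepro

namespace ThmN

set_option maxRecDepth 40000 in
/-- The base `(d, n₀) = (725, 1128)` of the `1/5681982737304658559486` form: `5681982737304658559486·G₁₀(725, 1128) ≤ 5681982737304658559485·2^1128`. -/
theorem gxtb_tail_ten_base_725 : 5681982737304658559486 * ((1128).choose 10 * 2 ^ (min 629 725) + (1128).choose 9 * 2 ^ 310 + (1128).choose 8 * 2 ^ 151 + (1128).choose 7 * 2 ^ 72 + (1128).choose 6 * 2 ^ 33 + (1128).choose 5 * 2 ^ 14 + (1128).choose 4 * 2 ^ 6 + (1128).choose 3 * 2 ^ 3 + (1128).choose 2 * 2 + 1128 + 1 + ∑ j ∈ Finset.range (725 + 1), (1128).choose j) ≤ 5681982737304658559485 * 2 ^ 1128 := by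
  simp only [Finset.sum_range_succ, Finset.sum_range_zero, Nat.choose_eq_descFactorial_div_factorial]; norm_num

set_option maxRecDepth 40000 in
/-- The base `(d, n₀) = (726, 1129)` of the `1/7329789236102279212953` form: `7329789236102279212953·G₁₀(726, 1129) ≤ 7329789236102279212952·2^1129`. -/
theorem gxtb_tail_ten_base_726 : 7329789236102279212953 * ((1129).choose 10 * 2 ^ (min 629 726) + (1129).choose 9 * 2 ^ 310 + (1129).choose 8 * 2 ^ 151 + (1129).choose 7 * 2 ^ 72 + (1129).choose 6 * 2 ^ 33 + (1129).choose 5 * 2 ^ 14 + (1129).choose 4 * 2 ^ 6 + (1129).choose 3 * 2 ^ 3 + (1129).choose 2 * 2 + 1129 + 1 + ∑ j ∈ Finset.range (726 + 1), (1129).choose j) ≤ 7329789236102279212952 * 2 ^ 1129 := by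
  simp only [Finset.sum_range_succ, Finset.sum_range_zero, Nat.choose_eq_descFactorial_div_factorial]; norm_num

end ThmN

end PercRepro
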